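import Summits.BirchSwinnertonDyer.BirchSwinnertonDyer.Theorems.AdditiveKolyvaginRoadManinFrameResidueProperRTameTwistResidue57
import HarnessLib

/-!
# Route `AdditiveKolyvaginRoad`, crux `ManinFrameResidueProperR` (stmt-BirchSwinnertonDyer-20709), line
# `tame-twist`, stub S57 (`p ∈ {5, 7}`): splitting `γ = γ₁ γ₂` into adjustable factors with quadratic-residue
# control at the resonant primes AND `−d_{γᵢ}` a square modulo `p` — `--supports`, helper

Cell `pub/bsd-wall`, seat `bsd-wall-manin-p1` g4. VERBATIM g3's `exists_eq_mul_adjustableL` (`…SplitL`) with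
ONE change: the residue of `d₂` modulo `p` is the fixed class `x₅ = 4` resp. `x₇ = 3`, so that — when `d_γ` is
a non-zero fourth power mod `p` (`γ = δ⁴`, `pow_four_entry_eq_pow_four`) — `−d_{γ₂} ≡ −x_p` and
`−d_{γ₁} ≡ −d_γ/x_p` are squares mod `p` (`residue57`); then the auxiliary prime `d′ ≡ d_{γᵢ} (mod p)`,
`d′ ≡ 3 (mod 4)` has `p` a square mod `d′`, hence `gcd(ord_{d′} p, p − 1) = 1` (`…OrderCoprime`). All proved.
-/
set_option autoImplicit false
set_option linter.dupNamespace false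
noncomputable section
open scoped MatrixGroups Classical
open CongruenceSubgroup Matrix
namespace Summit.BirchSwinnertonDyer.BirchSwinnertonDyer.Theorems.ManinFrameResidueProperRTameTwist
section Splitting57
variable {N : ℕ} {p : ℕ}
/-- **Splitting with quadratic-residue control at the resonant primes AND at `p ∈ {5, 7}`**: as g3's
`exists_eq_mul_adjustableL` (with `d_γ` a non-zero fourth power mod `p`), plus: `−d_{γ₁}`, `−d_{γ₂}` are squares
mod `p` (`d_{γ₂} ≡ x_p`, `d_{γ₁} ≡ d_γ/x_p`). [folklore] -/
theorem exists_eq_mul_adjustable57 (hp : p.Prime) (hp57 : p = 5 ∨ p = 7) (hpN : p ∣ N) (γ : Gamma0 N)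
    (hc : (γ : SL(2, ℤ)) 1 0 ≠ 0)
    (hd4 : ∃ d0 : ZMod p, d0 ≠ 0 ∧ ((((γ : SL(2, ℤ)) 1 1 : ℤ)) : ZMod p) = d0 ^ 4)
    (h3 : 3 ∣ p - 1 → (3 : ℤ) ∣ (γ : SL(2, ℤ)) 1 0 → (3 : ℤ) ∣ (γ : SL(2, ℤ)) 1 1 - 1)
    (h4 : (4 : ℤ) ∣ (γ : SL(2, ℤ)) 1 0 → (4 : ℤ) ∣ (γ : SL(2, ℤ)) 1 1 - 1)
    (B : Finset ℕ) (Q : ℕ → Prop)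
    (hB : ∀ ℓ ∈ B, ℓ.Prime ∧ p < ℓ ∧ (ℓ : ℤ) ∣ (γ : SL(2, ℤ)) 1 0)
    (hγB : ∀ ℓ ∈ B, IsSquare ((((γ : SL(2, ℤ)) 1 1 : ℤ)) : ZMod ℓ) ∧ ((((γ : SL(2, ℤ)) 1 1 : ℤ)) : ZMod ℓ) ≠ 0) :
    ∃ γ₁ γ₂ : Gamma0 N, γ = γ₁ * γ₂ ∧
      ((γ₁ : SL(2, ℤ)) 1 0 ≠ 0 ∧ ¬ (p : ℤ) ∣ (γ₁ : SL(2, ℤ)) 1 1 - 1 ∧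
        (∀ r : ℕ, r.Prime → r ≠ 2 → r ∣ p - 1 → (r : ℤ) ∣ (γ₁ : SL(2, ℤ)) 1 0 →
          ¬ (r : ℤ) ∣ (γ₁ : SL(2, ℤ)) 1 1 - 1) ∧
        ((4 : ℤ) ∣ (γ₁ : SL(2, ℤ)) 1 0 → (4 : ℤ) ∣ (γ₁ : SL(2, ℤ)) 1 1 - 3)) ∧
      ((γ₂ : SL(2, ℤ)) 1 0 ≠ 0 ∧ ¬ (p : ℤ) ∣ (γ₂ : SL(2, ℤ)) 1 1 - 1 ∧
        (∀ r : ℕ, r.Prime → r ≠ 2 → r ∣ p - 1 → (r : ℤ) ∣ (γ₂ : SL(2, ℤ)) 1 0 →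
          ¬ (r : ℤ) ∣ (γ₂ : SL(2, ℤ)) 1 1 - 1) ∧
        ((4 : ℤ) ∣ (γ₂ : SL(2, ℤ)) 1 0 → (4 : ℤ) ∣ (γ₂ : SL(2, ℤ)) 1 1 - 3)) ∧
      (∀ ℓ ∈ B, ((Q ℓ → IsSquare (-((((γ₁ : SL(2, ℤ)) 1 1 : ℤ)) : ZMod ℓ))) ∧
          (¬ Q ℓ → ¬ IsSquare (-((((γ₁ : SL(2, ℤ)) 1 1 : ℤ)) : ZMod ℓ)))) ∧
        ((Q ℓ → IsSquare (-((((γ₂ : SL(2, ℤ)) 1 1 : ℤ)) : ZMod ℓ))) ∧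
          (¬ Q ℓ → ¬ IsSquare (-((((γ₂ : SL(2, ℤ)) 1 1 : ℤ)) : ZMod ℓ))))) ∧
      (IsSquare (-((((γ₁ : SL(2, ℤ)) 1 1 : ℤ)) : ZMod p)) ∧
        IsSquare (-((((γ₂ : SL(2, ℤ)) 1 1 : ℤ)) : ZMod p))) := by
  have hp5 : 5 ≤ p := by rcases hp57 with rfl | rfl <;> norm_num
  haveI : Fact p.Prime := ⟨hp⟩
  -- the residue at `p`: `x_p = 4` (`p = 5`) resp. `3` (`p = 7`)
  obtain ⟨d0, hd00, hd0⟩ := hd4; obtain ⟨hxp0', hxp1', hxpd', hxpsq, hxpsq'⟩ := residue57 hp57 d0 hd00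
  set xp : ℕ := (if p = 5 then 4 else 3) with hxpdef
  have hxp0 : ¬ (p : ℤ) ∣ (xp : ℤ) := fun h ↦ hxp0' (by
    have := (ZMod.intCast_zmod_eq_zero_iff_dvd (xp : ℤ) p).mpr h; simpa using this)
  have hxp1 : ¬ (p : ℤ) ∣ (xp : ℤ) - 1 := fun h ↦ hxp1' (by
    have := ((ZMod.intCast_eq_intCast_iff_dvd_sub 1 (xp : ℤ) p).mpr h); push_cast at this; exact this.symm)
  have hxpd : ¬ (p : ℤ) ∣ (xp : ℤ) - (γ : SL(2, ℤ)) 1 1 := fun h ↦ hxpd' (by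
    have := ((ZMod.intCast_eq_intCast_iff_dvd_sub ((γ : SL(2, ℤ)) 1 1) (xp : ℤ) p).mpr h)
    rw [hd0] at this; simpa using this.symm)
  have hp2 : p ≠ 2 := by omega
  have hpc : (p : ℤ) ∣ (γ : SL(2, ℤ)) 1 0 :=
    (Int.natCast_dvd_natCast.mpr hpN).trans (natCast_dvd_entry10 γ)
  set S : Finset ℕ := insert p ((p - 1).primeFactors.erase 2) with hSdef
  have hSprime : ∀ q ∈ S, q.Prime ∧ q ≠ 2 := by
    intro q hq; rcases Finset.mem_insert.mp hq with rfl | hq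
    · exact ⟨hp, hp2⟩
    · exact ⟨Nat.prime_of_mem_primeFactors (Finset.mem_of_mem_erase hq), Finset.ne_of_mem_erase hq⟩
  have hS3 : ∀ q ∈ S, q = 3 → (q : ℤ) ∣ (γ : SL(2, ℤ)) 1 0 → (q : ℤ) ∣ (γ : SL(2, ℤ)) 1 1 - 1 := by
    intro q hq hq3 hqc; subst hq3
    rcases Finset.mem_insert.mp hq with h | h
    · omega
    · exact h3 (Nat.dvd_of_mem_primeFactors (Finset.mem_of_mem_erase h)) hqc
  have hres : ∀ q ∈ S, ∃ x : ℕ, ¬ (q : ℤ) ∣ x ∧ ¬ (q : ℤ) ∣ (x : ℤ) - (γ : SL(2, ℤ)) 1 1 ∧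
      ((q : ℤ) ∣ (γ : SL(2, ℤ)) 1 0 → ¬ (q : ℤ) ∣ (x : ℤ) - 1) := fun q hq ↦
    exists_residue q (hSprime q hq).1 (hSprime q hq).2 _ _ (hS3 q hq)
  let xr : ℕ → ℕ := fun q ↦ if q = p then xp else if hq : q ∈ S then Classical.choose (hres q hq) else 0
  have hxrp : xr p = xp := by simp only [xr, if_pos rfl]
  have hxr : ∀ q ∈ S, ¬ (q : ℤ) ∣ xr q ∧ ¬ (q : ℤ) ∣ (xr q : ℤ) - (γ : SL(2, ℤ)) 1 1 ∧
      ((q : ℤ) ∣ (γ : SL(2, ℤ)) 1 0 → ¬ (q : ℤ) ∣ (xr q : ℤ) - 1) := by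
    intro q hq; by_cases hqp : q = p
    · subst hqp; rw [hxrp]; exact ⟨hxp0, hxpd, fun _ ↦ hxp1⟩
    · simp only [xr, if_neg hqp, dif_pos hq]; exact Classical.choose_spec (hres q hq)
  have hS0 : ∀ q ∈ S, (q : ℕ) ≠ 0 := fun q hq ↦ (hSprime q hq).1.ne_zero
  have h4S : (4 : ℕ) ∉ S := fun h ↦ by have := (hSprime 4 h).1; exact absurd this (by decide)
  set S' : Finset ℕ := insert 4 S with hS'def
  let r₄ : ℕ := if (4 : ℤ) ∣ (γ : SL(2, ℤ)) 1 1 - 1 then 3 else 1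
  let xr' : ℕ → ℕ := fun q ↦ if q = 4 then r₄ else xr q
  have hxr'S : ∀ q ∈ S, xr' q = xr q := fun q hq ↦ by
    simp only [xr']; rw [if_neg]; rintro rfl; exact h4S hq
  have hS'0 : ∀ q ∈ S', (q : ℕ) ≠ 0 := fun q hq ↦ by
    rcases Finset.mem_insert.mp hq with rfl | hq
    · norm_num
    · exact hS0 q hq
  have hS'pair : Set.Pairwise (S' : Set ℕ) (Function.onFun Nat.Coprime fun q ↦ q) := by
    intro q hq q' hq' hne
    have hodd : ∀ r ∈ S, Nat.Coprime 4 r := fun r hr ↦ by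
      have h2 : Nat.Coprime 2 r := Nat.coprime_two_left.mpr ((hSprime r hr).1.odd_of_ne_two (hSprime r hr).2)
      simpa using h2.pow_left 2
    rcases Finset.mem_insert.mp hq with rfl | hq <;> rcases Finset.mem_insert.mp hq' with rfl | hq'
    · exact absurd rfl hne
    · exact hodd q' hq'
    · exact (hodd q hq).symm
    · exact (Nat.coprime_primes (hSprime q hq).1 (hSprime q' hq').1).mpr hne
  have hBprime : ∀ ℓ ∈ B, ℓ.Prime := fun ℓ hℓ ↦ (hB ℓ hℓ).1
  have hBres : ∀ ℓ ∈ B, ∃ x : ℕ, ((x : ZMod ℓ)) ≠ 0 ∧ (Q ℓ → IsSquare (-(x : ZMod ℓ))) ∧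
      (¬ Q ℓ → ¬ IsSquare (-(x : ZMod ℓ))) := by
    intro ℓ hℓ
    haveI : Fact ℓ.Prime := ⟨hBprime ℓ hℓ⟩
    have hℓ2 : ℓ ≠ 2 := by have := (hB ℓ hℓ).2.1; omega
    by_cases hQ : Q ℓ
    · refine ⟨ℓ - 1, ?_, fun _ ↦ ⟨1, ?_⟩, fun h ↦ absurd hQ h⟩
      · rw [Nat.cast_sub (hBprime ℓ hℓ).one_lt.le, Nat.cast_one, ZMod.natCast_self, zero_sub]
        exact neg_ne_zero.mpr one_ne_zero
      · rw [Nat.cast_sub (hBprime ℓ hℓ).one_lt.le, Nat.cast_one, ZMod.natCast_self]; ring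
    · obtain ⟨y, hy⟩ := FiniteField.exists_nonsquare (F := ZMod ℓ) (by rw [ZMod.ringChar_zmod_n]; exact hℓ2)
      refine ⟨(-y).val, ?_, fun h ↦ absurd h hQ, fun _ ↦ ?_⟩
      · rw [ZMod.natCast_zmod_val]; intro h0
        exact hy (by rw [neg_eq_zero.mp h0]; exact ⟨0, by ring⟩)
      · rw [ZMod.natCast_zmod_val, neg_neg]; exact hy
  let xB : ℕ → ℕ := fun ℓ ↦ if hℓ : ℓ ∈ B then Classical.choose (hBres ℓ hℓ) else 0
  have hxB : ∀ ℓ ∈ B, ((xB ℓ : ZMod ℓ)) ≠ 0 ∧ (Q ℓ → IsSquare (-(xB ℓ : ZMod ℓ))) ∧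
      (¬ Q ℓ → ¬ IsSquare (-(xB ℓ : ZMod ℓ))) := by
    intro ℓ hℓ; simp only [xB, dif_pos hℓ]; exact Classical.choose_spec (hBres ℓ hℓ)
  have hBS' : ∀ ℓ ∈ B, ℓ ∉ S' := by
    intro ℓ hℓ hmem; rcases Finset.mem_insert.mp hmem with h4eq | hS
    · exact absurd (hBprime ℓ hℓ) (by rw [h4eq]; decide)
    · rcases Finset.mem_insert.mp hS with hpeq | hr
      · have := (hB ℓ hℓ).2.1; omega
      · have hle : ℓ ≤ p - 1 := Nat.le_of_dvd (by have := hp.two_le; omega)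
          (Nat.dvd_of_mem_primeFactors (Finset.mem_of_mem_erase hr))
        have := (hB ℓ hℓ).2.1; omega
  set S'' : Finset ℕ := S' ∪ B with hS''def
  let xr'' : ℕ → ℕ := fun q ↦ if q ∈ B then xB q else xr' q
  have hxr''S' : ∀ q ∈ S', xr'' q = xr' q := fun q hq ↦ by
    simp only [xr'']; rw [if_neg]; exact fun hqB ↦ hBS' q hqB hq
  have hxr''B : ∀ q ∈ B, xr'' q = xB q := fun q hq ↦ by simp only [xr'', if_pos hq]
  have hS''0 : ∀ q ∈ S'', (q : ℕ) ≠ 0 := fun q hq ↦ by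
    rcases Finset.mem_union.mp hq with hq | hq
    · exact hS'0 q hq
    · exact (hBprime q hq).ne_zero
  have hS''pair : Set.Pairwise (S'' : Set ℕ) (Function.onFun Nat.Coprime fun q ↦ q) := by
    intro q hq q' hq' hne
    have hcopB : ∀ ℓ ∈ B, ∀ r ∈ S', Nat.Coprime ℓ r := by
      intro ℓ hℓ r hr; rcases Finset.mem_insert.mp hr with rfl | hrS
      · have h2 : Nat.Coprime 2 ℓ := Nat.coprime_two_left.mpr ((hBprime ℓ hℓ).odd_of_ne_two
          (by have := (hB ℓ hℓ).2.1; omega))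
        simpa using (h2.pow_left 2).symm
      · exact (Nat.coprime_primes (hBprime ℓ hℓ) (hSprime r hrS).1).mpr
          (fun h ↦ hBS' ℓ hℓ (h ▸ Finset.mem_insert_of_mem hrS))
    rcases Finset.mem_union.mp hq with hq | hq <;> rcases Finset.mem_union.mp hq' with hq' | hq'
    · exact hS'pair hq hq' hne
    · exact (hcopB q' hq' q hq).symm
    · exact hcopB q hq q' hq'
    · exact (Nat.coprime_primes (hBprime q hq) (hBprime q' hq')).mpr hne
  obtain ⟨x₀, hx₀⟩ := Nat.chineseRemainderOfFinset xr'' (fun q ↦ q) S'' hS''0 hS''pair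
  set M : ℕ := ∏ q ∈ S'', q with hMdef
  have hM0 : M ≠ 0 := Finset.prod_ne_zero_iff.mpr hS''0
  have hx₀M : x₀.Coprime M := by
    refine Nat.Coprime.prod_right fun q hq ↦ ?_; rcases Finset.mem_union.mp hq with hqS' | hqB
    · rcases Finset.mem_insert.mp hqS' with rfl | hqS
      · -- modulo `4`: `x₀ ≡ r₄ ∈ {1, 3}`
        have h1 : x₀ ≡ r₄ [MOD 4] := by
          have := hx₀ 4 hq; rw [hxr''S' 4 hqS'] at this; simpa [xr'] using this
        have hr₄ : r₄ = 3 ∨ r₄ = 1 := by simp only [r₄]; split_ifs <;> simp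
        have hodd : Odd x₀ := by
          rw [Nat.odd_iff]
          have h2 : x₀ % 4 = r₄ % 4 := h1
          rcases hr₄ with h | h <;> rw [h] at h2 <;> omega
        simpa using (Nat.coprime_two_left.mpr hodd).symm.pow_right 2
      · refine Nat.coprime_comm.mp (((hSprime q hqS).1.coprime_iff_not_dvd).mpr fun h ↦ (hxr q hqS).1 ?_)
        have h1 : (q : ℤ) ∣ (x₀ : ℤ) - xr q := by
          have := (Nat.modEq_iff_dvd.mp (hx₀ q hq))
          rw [hxr''S' q hqS', hxr'S q hqS] at this; rwa [dvd_sub_comm] at this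
        have h2 : (q : ℤ) ∣ (x₀ : ℤ) := by exact_mod_cast h
        have := dvd_sub h2 h1
        rwa [sub_sub_cancel] at this
    · haveI : Fact q.Prime := ⟨hBprime q hqB⟩
      refine Nat.coprime_comm.mp (((hBprime q hqB).coprime_iff_not_dvd).mpr fun h ↦ (hxB q hqB).1 ?_)
      have h1 : ((x₀ : ZMod q)) = (xB q : ZMod q) := by
        have := (ZMod.natCast_eq_natCast_iff' x₀ (xr'' q) q).mpr (hx₀ q hq)
        rw [hxr''B q hqB] at this; exact this
      rw [← h1, ZMod.natCast_eq_zero_iff]; exact h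
  obtain ⟨d₂, hd₂c, hd₂p, hd₂x⟩ :=
    Nat.forall_exists_prime_gt_and_modEq ((γ : SL(2, ℤ)) 1 0).natAbs hM0 hx₀M
  have hd₂q : ∀ q ∈ S, (q : ℤ) ∣ (d₂ : ℤ) - xr q := by
    intro q hq
    have hqS' : q ∈ S' := Finset.mem_insert_of_mem hq
    have hqS'' : q ∈ S'' := Finset.mem_union_left _ hqS'
    have h1 : d₂ ≡ xr q [MOD q] := by
      have := (Nat.ModEq.of_dvd (Finset.dvd_prod_of_mem _ hqS'') hd₂x).trans (hx₀ q hqS'')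
      rwa [hxr''S' q hqS', hxr'S q hq] at this
    have := Nat.modEq_iff_dvd.mp h1
    rwa [dvd_sub_comm] at this
  have hd₂4 : (4 : ℤ) ∣ (d₂ : ℤ) - r₄ := by
    have h4S' : (4 : ℕ) ∈ S' := Finset.mem_insert_self 4 S
    have h4S'' : (4 : ℕ) ∈ S'' := Finset.mem_union_left _ h4S'
    have h1 : d₂ ≡ r₄ [MOD 4] := by
      have := (Nat.ModEq.of_dvd (Finset.dvd_prod_of_mem _ h4S'') hd₂x).trans (hx₀ 4 h4S'')
      rw [hxr''S' 4 h4S'] at this; simpa [xr'] using this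
    have := Nat.modEq_iff_dvd.mp h1
    rw [dvd_sub_comm] at this; exact_mod_cast this
  have hd₂B : ∀ ℓ ∈ B, ((d₂ : ℤ) : ZMod ℓ) = (xB ℓ : ZMod ℓ) := by
    intro ℓ hℓ
    have hℓS'' : ℓ ∈ S'' := Finset.mem_union_right _ hℓ
    have h1 : d₂ ≡ xB ℓ [MOD ℓ] := by
      have := (Nat.ModEq.of_dvd (Finset.dvd_prod_of_mem _ hℓS'') hd₂x).trans (hx₀ ℓ hℓS'')
      rwa [hxr''B ℓ hℓ] at this
    have := (ZMod.natCast_eq_natCast_iff' d₂ (xB ℓ) ℓ).mpr h1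
    rw [Int.cast_natCast]; exact this
  have hd₂d : ∀ q ∈ S, ¬ (q : ℤ) ∣ (d₂ : ℤ) - (γ : SL(2, ℤ)) 1 1 := by
    intro q hq h; apply (hxr q hq).2.1
    rw [show (xr q : ℤ) - (γ : SL(2, ℤ)) 1 1 = ((d₂ : ℤ) - (γ : SL(2, ℤ)) 1 1) - ((d₂ : ℤ) - xr q)
      by ring]
    exact dvd_sub h (hd₂q q hq)
  have hd₂1 : ∀ q ∈ S, (q : ℤ) ∣ (γ : SL(2, ℤ)) 1 0 → ¬ (q : ℤ) ∣ (d₂ : ℤ) - 1 := by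
    intro q hq hqc h; apply (hxr q hq).2.2 hqc
    rw [show (xr q : ℤ) - 1 = ((d₂ : ℤ) - 1) - ((d₂ : ℤ) - xr q) by ring]
    exact dvd_sub h (hd₂q q hq)
  have hcop : IsCoprime (d₂ : ℤ) ((γ : SL(2, ℤ)) 1 0) := by
    refine Literature.NumberTheory.ModularForms.OrdinaryCusps.isCoprime_natCast_of_not_dvd hd₂p fun h ↦ ?_
    exact Nat.not_dvd_of_pos_of_lt (Int.natAbs_pos.mpr hc) hd₂c (Int.natCast_dvd.mp h)
  obtain ⟨u, v, huv⟩ := hcop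
  let M₂ : SL(2, ℤ) := ⟨!![u, -v; (γ : SL(2, ℤ)) 1 0, (d₂ : ℤ)], by
    rw [Matrix.det_fin_two_of]; linear_combination huv⟩
  have hM₂ : M₂ ∈ Gamma0 N := by
    rw [Gamma0_mem]; exact Gamma0_mem.mp γ.2
  let γ₂ : Gamma0 N := ⟨M₂, hM₂⟩
  let γ₁ : Gamma0 N := γ * γ₂⁻¹
  have e2_10 : ((γ₂ : SL(2, ℤ)) 1 0 : ℤ) = (γ : SL(2, ℤ)) 1 0 := rfl
  have e2_11 : ((γ₂ : SL(2, ℤ)) 1 1 : ℤ) = d₂ := rfl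
  have hmat : ∀ i j : Fin 2, ((γ₁ : SL(2, ℤ)) i j : ℤ) =
      ((γ : SL(2, ℤ)).1 * M₂.1.adjugate) i j := fun _ _ ↦ rfl
  have e1_10 : ((γ₁ : SL(2, ℤ)) 1 0 : ℤ) = (γ : SL(2, ℤ)) 1 0 * ((d₂ : ℤ) - (γ : SL(2, ℤ)) 1 1) := by
    rw [hmat]
    simp only [M₂, Matrix.adjugate_fin_two_of, Matrix.mul_apply, Fin.sum_univ_two, Matrix.of_apply,
      Matrix.cons_val', Matrix.cons_val_zero, Matrix.cons_val_one]
    ring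
  have e1_11 : ((γ₁ : SL(2, ℤ)) 1 1 : ℤ) = (γ : SL(2, ℤ)) 1 0 * v + (γ : SL(2, ℤ)) 1 1 * u := by
    rw [hmat]
    simp only [M₂, Matrix.adjugate_fin_two_of, Matrix.mul_apply, Fin.sum_univ_two, Matrix.of_apply,
      Matrix.cons_val', Matrix.cons_val_zero, Matrix.cons_val_one, neg_neg]
  have hkey : ∀ q : ℕ, (q : ℤ) ∣ (γ : SL(2, ℤ)) 1 0 →
      (q : ℤ) ∣ ((γ : SL(2, ℤ)) 1 0 * v + (γ : SL(2, ℤ)) 1 1 * u) - 1 →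
      (q : ℤ) ∣ (d₂ : ℤ) - (γ : SL(2, ℤ)) 1 1 := by
    intro q hqc h
    have hid : (d₂ : ℤ) - (γ : SL(2, ℤ)) 1 1 =
        (γ : SL(2, ℤ)) 1 0 * (v * ((d₂ : ℤ) - (γ : SL(2, ℤ)) 1 1)) -
          (((γ : SL(2, ℤ)) 1 0 * v + (γ : SL(2, ℤ)) 1 1 * u) - 1) * d₂ := by
      linear_combination (γ : SL(2, ℤ)) 1 1 * huv
    rw [hid]; exact dvd_sub (hqc.trans (dvd_mul_right _ _)) (h.trans (dvd_mul_right _ _))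
  have hpS : p ∈ S := Finset.mem_insert_self _ _
  have hrS : ∀ r : ℕ, r.Prime → r ≠ 2 → r ∣ p - 1 → r ∈ S := fun r hr hr2 hrp ↦
    Finset.mem_insert_of_mem (Finset.mem_erase.mpr ⟨hr2,
      Nat.mem_primeFactors.mpr ⟨hr, hrp, Nat.sub_ne_zero_of_lt hp.one_lt⟩⟩)
  have hid4 : ((γ : SL(2, ℤ)) 1 0 * v + (γ : SL(2, ℤ)) 1 1 * u) * (d₂ : ℤ) - (γ : SL(2, ℤ)) 1 1 =
      (γ : SL(2, ℤ)) 1 0 * v * ((d₂ : ℤ) - (γ : SL(2, ℤ)) 1 1) := by linear_combination (γ : SL(2, ℤ)) 1 1 * huv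
  have hcd : (2 : ℤ) ∣ (γ : SL(2, ℤ)) 1 0 → ¬ (2 : ℤ) ∣ (γ : SL(2, ℤ)) 1 1 := by
    intro h2c h2d; have hdet := entry_det γ
    have : (2 : ℤ) ∣ (γ : SL(2, ℤ)) 0 0 * (γ : SL(2, ℤ)) 1 1 - (γ : SL(2, ℤ)) 0 1 * (γ : SL(2, ℤ)) 1 0 :=
      dvd_sub (h2d.mul_left _) (h2c.mul_left _)
    rw [hdet] at this; exact absurd (Int.le_of_dvd one_pos this) (by norm_num)
  have key4 : ∀ C D D2 V D1 : ZMod 4, D1 * D2 - D = C * V * (D2 - D) →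
      D2 = (if D = 1 then 3 else 1) → (C = 0 → D = 1) → ((C = 0 ∨ C = 2) → (D = 1 ∨ D = 3)) →
      C * (D2 - D) = 0 → D1 = 3 := by decide
  have hD2 : ((d₂ : ℤ) : ZMod 4) = if (((γ : SL(2, ℤ)) 1 1 : ℤ) : ZMod 4) = 1 then 3 else 1 := by
    have h := ((ZMod.intCast_eq_intCast_iff_dvd_sub (r₄ : ℤ) d₂ 4).mpr hd₂4).symm
    rw [h]; simp only [r₄]
    by_cases hd1 : (4 : ℤ) ∣ (γ : SL(2, ℤ)) 1 1 - 1
    · rw [if_pos hd1, if_pos]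
      · norm_num
      · have := ((ZMod.intCast_eq_intCast_iff_dvd_sub 1 ((γ : SL(2, ℤ)) 1 1) 4).mpr hd1).symm
        simpa using this
    · rw [if_neg hd1, if_neg]
      · norm_num
      · intro h
        exact hd1 ((ZMod.intCast_eq_intCast_iff_dvd_sub 1 ((γ : SL(2, ℤ)) 1 1) 4).mp (by simpa using h.symm))
  have hC0 : ((((γ : SL(2, ℤ)) 1 0 : ℤ) : ZMod 4) = 0 → ((((γ : SL(2, ℤ)) 1 1 : ℤ) : ZMod 4)) = 1) := by
    intro h0
    have h4c : (4 : ℤ) ∣ (γ : SL(2, ℤ)) 1 0 := (ZMod.intCast_zmod_eq_zero_iff_dvd _ 4).mp h0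
    have := ((ZMod.intCast_eq_intCast_iff_dvd_sub 1 ((γ : SL(2, ℤ)) 1 1) 4).mpr (h4 h4c)).symm
    simpa using this
  have hCD : ((((γ : SL(2, ℤ)) 1 0 : ℤ) : ZMod 4) = 0 ∨ (((γ : SL(2, ℤ)) 1 0 : ℤ) : ZMod 4) = 2) →
      ((((γ : SL(2, ℤ)) 1 1 : ℤ) : ZMod 4) = 1 ∨ (((γ : SL(2, ℤ)) 1 1 : ℤ) : ZMod 4) = 3) := by
    intro h
    have h2c : (2 : ℤ) ∣ (γ : SL(2, ℤ)) 1 0 := by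
      rcases h with h | h
      · exact (show (2 : ℤ) ∣ 4 by norm_num).trans ((ZMod.intCast_zmod_eq_zero_iff_dvd _ 4).mp h)
      · have := (ZMod.intCast_eq_intCast_iff_dvd_sub 2 ((γ : SL(2, ℤ)) 1 0) 4).mp (by simpa using h.symm)
        have := dvd_add ((show (2 : ℤ) ∣ 4 by norm_num).trans this) (dvd_refl (2 : ℤ))
        simpa using this
    have hodd := hcd h2c
    have key : ∀ D : ZMod 4, D ≠ 0 → D ≠ 2 → D = 1 ∨ D = 3 := by decide
    refine key _ (fun h0 ↦ hodd ?_) (fun h2 ↦ hodd ?_)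
    · exact (show (2 : ℤ) ∣ 4 by norm_num).trans ((ZMod.intCast_zmod_eq_zero_iff_dvd _ 4).mp h0)
    · have := (ZMod.intCast_eq_intCast_iff_dvd_sub 2 ((γ : SL(2, ℤ)) 1 1) 4).mp (by simpa using h2.symm)
      have := dvd_add ((show (2 : ℤ) ∣ 4 by norm_num).trans this) (dvd_refl (2 : ℤ))
      simpa using this
  have hmod4₁ : (4 : ℤ) ∣ (γ : SL(2, ℤ)) 1 0 * ((d₂ : ℤ) - (γ : SL(2, ℤ)) 1 1) →
      (4 : ℤ) ∣ ((γ : SL(2, ℤ)) 1 0 * v + (γ : SL(2, ℤ)) 1 1 * u) - 3 := by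
    intro h
    have hid4' := congrArg (fun z : ℤ ↦ (z : ZMod 4)) hid4
    push_cast at hid4'
    have h0 : ((((γ : SL(2, ℤ)) 1 0 : ℤ) : ZMod 4)) * (((d₂ : ℤ) : ZMod 4) - (((γ : SL(2, ℤ)) 1 1 : ℤ) : ZMod 4)) = 0 := by
      have := (ZMod.intCast_zmod_eq_zero_iff_dvd _ 4).mpr h
      push_cast at this; exact this
    have := key4 _ _ _ _ _ hid4' hD2 hC0 hCD h0
    have h1 := (ZMod.intCast_eq_intCast_iff_dvd_sub 3 ((γ : SL(2, ℤ)) 1 0 * v + (γ : SL(2, ℤ)) 1 1 * u) 4).mp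
      (by push_cast; exact this.symm)
    exact h1
  have hBfin : ∀ ℓ ∈ B, ((Q ℓ → IsSquare (-(((((γ : SL(2, ℤ)) 1 0 * v + (γ : SL(2, ℤ)) 1 1 * u : ℤ)) :
      ZMod ℓ)))) ∧ (¬ Q ℓ → ¬ IsSquare (-(((((γ : SL(2, ℤ)) 1 0 * v + (γ : SL(2, ℤ)) 1 1 * u : ℤ)) :
      ZMod ℓ))))) ∧ ((Q ℓ → IsSquare (-(((d₂ : ℤ)) : ZMod ℓ))) ∧
        (¬ Q ℓ → ¬ IsSquare (-(((d₂ : ℤ)) : ZMod ℓ)))) := by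
    intro ℓ hℓ
    haveI : Fact ℓ.Prime := ⟨hBprime ℓ hℓ⟩
    obtain ⟨⟨s, hs⟩, hd0⟩ := hγB ℓ hℓ
    have h2props := hxB ℓ hℓ
    have hD2 : (((d₂ : ℤ)) : ZMod ℓ) = (xB ℓ : ZMod ℓ) := hd₂B ℓ hℓ
    have hd₂0 : (((d₂ : ℤ)) : ZMod ℓ) ≠ 0 := by rw [hD2]; exact h2props.1
    have hs0 : s ≠ 0 := by rintro rfl; exact hd0 (by rw [hs]; ring)
    have hcℓ : ((((γ : SL(2, ℤ)) 1 0 : ℤ)) : ZMod ℓ) = 0 :=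
      (ZMod.intCast_zmod_eq_zero_iff_dvd _ ℓ).mpr (hB ℓ hℓ).2.2
    have hprodℓ : ((((γ : SL(2, ℤ)) 1 0 * v + (γ : SL(2, ℤ)) 1 1 * u : ℤ)) : ZMod ℓ) *
        (((d₂ : ℤ)) : ZMod ℓ) = s * s := by
      rw [← hs]
      have h := congrArg (fun z : ℤ ↦ (z : ZMod ℓ)) hid4
      push_cast at h ⊢; simp only [hcℓ, zero_mul, zero_add] at h ⊢
      linear_combination h
    have hD1 : ((((γ : SL(2, ℤ)) 1 0 * v + (γ : SL(2, ℤ)) 1 1 * u : ℤ)) : ZMod ℓ) =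
        s * s * ((((d₂ : ℤ)) : ZMod ℓ))⁻¹ := by
      rw [← hprodℓ, mul_assoc, mul_inv_cancel₀ hd₂0, mul_one]
    have e1 : s * s⁻¹ = 1 := mul_inv_cancel₀ hs0
    have e2 : (((d₂ : ℤ)) : ZMod ℓ) * ((((d₂ : ℤ)) : ZMod ℓ))⁻¹ = 1 := mul_inv_cancel₀ hd₂0
    have hiff : IsSquare (-((((γ : SL(2, ℤ)) 1 0 * v + (γ : SL(2, ℤ)) 1 1 * u : ℤ)) : ZMod ℓ)) ↔
        IsSquare (-(((d₂ : ℤ)) : ZMod ℓ)) := by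
      rw [hD1]; constructor
      · rintro ⟨t, ht⟩; refine ⟨t * (((d₂ : ℤ)) : ZMod ℓ) * s⁻¹, ?_⟩
        have : -(((d₂ : ℤ) : ZMod ℓ)) = -(s * s * (((d₂ : ℤ)) : ZMod ℓ)⁻¹) *
            ((((d₂ : ℤ)) : ZMod ℓ) * s⁻¹) * ((((d₂ : ℤ)) : ZMod ℓ) * s⁻¹) := by
          linear_combination ((((d₂ : ℤ)) : ZMod ℓ) * (s * s⁻¹) ^ 2) * e2 +
            ((((d₂ : ℤ)) : ZMod ℓ) * (s * s⁻¹ + 1)) * e1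
        rw [this, ht]; ring
      · rintro ⟨t, ht⟩; refine ⟨t * s * ((((d₂ : ℤ)) : ZMod ℓ))⁻¹, ?_⟩
        have : -(s * s * (((d₂ : ℤ)) : ZMod ℓ)⁻¹) = -(((d₂ : ℤ) : ZMod ℓ)) *
            (s * ((((d₂ : ℤ)) : ZMod ℓ))⁻¹) * (s * ((((d₂ : ℤ)) : ZMod ℓ))⁻¹) := by
          linear_combination (s * s * ((((d₂ : ℤ)) : ZMod ℓ))⁻¹) * e2
        rw [this, ht]; ring
    have h2sq : (Q ℓ → IsSquare (-(((d₂ : ℤ)) : ZMod ℓ))) ∧ (¬ Q ℓ → ¬ IsSquare (-(((d₂ : ℤ)) : ZMod ℓ))) := by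
      rw [hD2]; exact ⟨h2props.2.1, h2props.2.2⟩
    exact ⟨⟨fun hQ ↦ hiff.mpr (h2sq.1 hQ), fun hQ h ↦ h2sq.2 hQ (hiff.mp h)⟩, h2sq⟩
  refine ⟨γ₁, γ₂, (inv_mul_cancel_right γ γ₂).symm, ⟨?_, ?_, ?_, ?_⟩, ⟨?_, ?_, ?_, ?_⟩, fun ℓ hℓ ↦ ?_, ?_⟩
  · -- `c₁ ≠ 0`
    rw [e1_10]; refine mul_ne_zero hc (sub_ne_zero.mpr fun h ↦ hd₂d p hpS ?_)
    rw [h, sub_self]; exact dvd_zero _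
  · rw [e1_11]; exact fun h ↦ hd₂d p hpS (hkey p hpc h)
  · intro r hr hr2 hrp hrc; rw [e1_11]; rw [e1_10] at hrc
    have hrc' : (r : ℤ) ∣ (γ : SL(2, ℤ)) 1 0 := by
      rcases (Int.prime_iff_natAbs_prime.mpr (by simpa using hr)).dvd_or_dvd hrc with h | h
      · exact h
      · exact absurd h (hd₂d r (hrS r hr hr2 hrp))
    exact fun h ↦ hd₂d r (hrS r hr hr2 hrp) (hkey r hrc' h)
  · rw [e1_10, e1_11]; exact hmod4₁
  · rw [e2_10]; exact hc
  · rw [e2_11]; exact hd₂1 p hpS hpc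
  · intro r hr hr2 hrp hrc; rw [e2_11]; rw [e2_10] at hrc
    exact hd₂1 r (hrS r hr hr2 hrp) hrc
  · rw [e2_10, e2_11]; intro h4c
    have hd1 := h4 h4c
    have : (r₄ : ℤ) = 3 := by simp only [r₄, if_pos hd1]; norm_num
    rw [this] at hd₂4; exact hd₂4
  · rw [e1_11, e2_11]; exact hBfin ℓ hℓ
  · -- the classes modulo `p`: `d₂ ≡ x_p`, `d₁ ≡ d / x_p`
    rw [e1_11, e2_11]
    have hD2 : (((d₂ : ℤ)) : ZMod p) = ((xp : ℕ) : ZMod p) := by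
      have h := (ZMod.intCast_eq_intCast_iff_dvd_sub (xr p : ℤ) (d₂ : ℤ) p).mpr (hd₂q p hpS)
      rw [hxrp] at h; simpa using h.symm
    have hcp : ((((γ : SL(2, ℤ)) 1 0 : ℤ)) : ZMod p) = 0 := (ZMod.intCast_zmod_eq_zero_iff_dvd _ p).mpr hpc
    have hprod : ((((γ : SL(2, ℤ)) 1 0 * v + (γ : SL(2, ℤ)) 1 1 * u : ℤ)) : ZMod p) *
        ((xp : ℕ) : ZMod p) = d0 ^ 4 := by
      rw [← hD2, ← hd0]
      have h := congrArg (fun z : ℤ ↦ (z : ZMod p)) hid4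
      push_cast at h ⊢; simp only [hcp, zero_mul, zero_add] at h ⊢
      linear_combination h
    have hD1 : ((((γ : SL(2, ℤ)) 1 0 * v + (γ : SL(2, ℤ)) 1 1 * u : ℤ)) : ZMod p) =
        d0 ^ 4 * (((xp : ℕ) : ZMod p))⁻¹ := by
      rw [← hprod, mul_assoc, mul_inv_cancel₀ hxp0', mul_one]
    refine ⟨?_, ?_⟩
    · rw [hD1]; obtain ⟨r, hr⟩ := hxpsq'; refine ⟨r, ?_⟩
      rw [← neg_mul, hr, mul_assoc, mul_inv_cancel₀ hxp0', mul_one]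
    · rw [hD2]; obtain ⟨r, hr⟩ := hxpsq; exact ⟨r, hr⟩
end Splitting57
end Summit.BirchSwinnertonDyer.BirchSwinnertonDyer.Theorems.ManinFrameResidueProperRTameTwist

end

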